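import Summits.BirchSwinnertonDyer.BirchSwinnertonDyer.Theorems.RamifiedSevenEllipticUnitsStrictControlAnyPrime
import HarnessLib

set_option linter.dupNamespace false

/-!
# `E(K_v)[p] = 0` at a place `v ∤ p` of an arbitrary number field above an ADDITIVE prime `ℓ` of `E/ℚ`
# unramified in `K` (`p ≥ 5`) — the reusable form of the (Av) input of route `RamifiedSevenEllipticUnits`

Cell `bsd-cm`, seat `bsd-cm-k7r-c4` (g4). HONEST FRAMING: a local lemma; closes nothing; BSD is not
proved by any of this. `…StrictControlAnyPrime.good_or_noPTorsion_of_isFrame` proved the away-from-`p`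
input (Av) of the exact-control theorem INSIDE an O11 frame (CM field `K`, `d_K = −p`). The argument
is general and is recorded here in reusable form for the other corners of the partition that run a
control theorem over a number field `K` at the bad ADDITIVE primes of a curve `E/ℚ` (inert-bad CM
pairs, quadratic-branch / Kato descents): for ANY number field `K`, any finite place `v` of `K` above a
rational prime `ℓ` with `ℓ ∤ d_K` (so `e(v | ℓ) = 1`) at which `E/ℚ` has neither good nor
multiplicative reduction, and any prime `p ≥ 5`, `p ≠ ℓ`: `E(K_v)[p] = 0`. Proof: the ADDITIVE type
ascends along the unramified `ℚ_ℓ → K_v` (tree theorem A233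
`kodairaSymbolAt_baseChange_of_ramificationIdx_eq_one_holds`, Silverman *AEC* VII.5.4 (a)), and
Mazur's Step 1 over the discrete valuation ring `𝒪_v` (`[E(K_v) : E₀(K_v)] ≤ 4 < p`, `E₀/E₁ ↪ k̄_v⁺`
has no `p`-torsion as `char k_v = ℓ ≠ p`, `E₁(K_v)` is pro-`ℓ`;
`eq_zero_of_hasAdditiveReduction_of_prime_nsmul_eq_zero`) on the `𝒪_v`-minimal model, transported to
the given equation.

* `hasAdditiveReductionAt_ratPlace_of_not_good_of_not_mult` — `¬ Good ∧ ¬ Mult` at `ℓ` ⇒ additive at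
  the place of `ℚ` under `v`;
* `noPTorsion_adicCompletion_of_hasAdditiveReductionAt` — `W_K` additive at `v`, `p ≥ 5`, `v ∤ p` ⇒
  `W_K(K_v)[p] = 0`;
* **`noPTorsion_adicCompletion_of_not_good_of_not_mult_of_not_dvd_discr`** — the statement above.

References: [SilvermanAEC2009] Prop. VII.5.4 (a); [Mazur1977] Ch. III §5 Step 1 (p. 158);
[SilvermanATAEC1994] Cor. IV.9.2(d).
-/

noncomputable section

open scoped Classical

open WeierstrassCurve NumberField IsDedekindDomain Field
  Literature.NumberTheory.EllipticCurves
  Literature.NumberTheory.EllipticCurves.Rank1Residual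
  Literature.NumberTheory.DiophantineGeometry
  Summit.BirchSwinnertonDyer.Rank1Residual
  Summit.BirchSwinnertonDyer.Rank1Residual.X11b

namespace Summit.BirchSwinnertonDyer.BirchSwinnertonDyer.Theorems.RamifiedSevenEllipticUnits

/-- **Neither good nor multiplicative at `ℓ` ⇒ additive at the place `v₀` of `ℚ` with `primesEquiv v₀ = ℓ`**
(trichotomy on the chosen `𝒪_{v₀}`-minimal model; the prime-indexed and place-indexed predicates agree,
`hasGoodReductionAtPrime_primesEquiv_iff_holds` / `hasMultiplicativeReductionAtPrime_primesEquiv_iff_holds`).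
[cite: SilvermanAEC2009, VII.5 Prop. 5.1] -/
theorem hasAdditiveReductionAt_ratPlace_of_not_good_of_not_mult (W : WeierstrassCurve ℚ) [W.IsElliptic]
    (ℓ : ℕ) [Fact ℓ.Prime] (hg : ¬ Good W ℓ) (hm : ¬ Mult W ℓ) (v₀ : HeightOneSpectrum (𝓞 ℚ))
    (hv₀ : (Rat.HeightOneSpectrum.primesEquiv v₀ : ℕ) = ℓ) : W.HasAdditiveReductionAt v₀ := by
  have hng : ¬ W.HasGoodReductionAt v₀ := fun h ↦
    hg ((hasGoodReductionAtPrime_primesEquiv_iff_holds W v₀ ℓ hv₀).mpr h)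
  have hnm : ¬ W.HasMultiplicativeReductionAt v₀ := fun h ↦
    hm ((hasMultiplicativeReductionAtPrime_primesEquiv_iff_holds W v₀ ℓ hv₀).mpr h)
  rcases hasGoodReduction_or_hasMultiplicativeReduction_or_hasAdditiveReduction
      (v₀.adicCompletionIntegers ℚ) (W := W.localMinimalModel v₀) with h | h | h
  · exact absurd (show W.HasGoodReductionAt v₀ from h) hng
  · exact absurd (show W.HasMultiplicativeReductionAt v₀ from h) hnm
  · exact h

/-- **Additive reduction of `W_K` at `v ∤ p`, `p ≥ 5` ⇒ `W_K(K_v)[p] = 0`** (Mazur's Step 1 at `q ≠ N`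
over the discrete valuation ring `𝒪_v`, on the `𝒪_v`-minimal model, transported to the given equation
along the minimising variable change). Any number field `K`, any `W/ℚ`.
[cite: Mazur1977, Ch. III §5 Step 1 (p. 158)] [cite: SilvermanATAEC1994, Cor. IV.9.2(d)] -/
theorem noPTorsion_adicCompletion_of_hasAdditiveReductionAt (W : WeierstrassCurve ℚ) [W.IsElliptic]
    {p : ℕ} (hp : p.Prime) (h5 : 5 ≤ p) {K : Type} [Field K] [NumberField K]
    (v : HeightOneSpectrum (𝓞 K)) (hpv : ((p : ℕ) : 𝓞 K) ∉ v.asIdeal)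
    (hadd : (W.baseChange K).HasAdditiveReductionAt v) :
    ∀ R : ((W.baseChange K).baseChange (v.adicCompletion K)).toAffine.Point, p • R = 0 → R = 0 := by
  haveI : Finite (IsLocalRing.ResidueField (v.adicCompletionIntegers K)) :=
    HeightOneSpectrum.finite_residueField_adicCompletionIntegers K v
  haveI : PerfectField (IsLocalRing.ResidueField (v.adicCompletionIntegers K)) := PerfectField.ofFinite
  have hmin : (((W.baseChange K).baseChange (v.adicCompletion K)).minimal
      (v.adicCompletionIntegers K)).HasAdditiveReduction (v.adicCompletionIntegers K) := hadd
  haveI := hmin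
  haveI : (((W.baseChange K).baseChange (v.adicCompletion K)).minimal
      (v.adicCompletionIntegers K)).IsElliptic := by
    unfold minimal baseChange; infer_instance
  have hpk : (p : IsLocalRing.ResidueField (v.adicCompletionIntegers K)) ≠ 0 :=
    WeierstrassCurve.natCast_residueField_ne_zero hpv
  have hX : ∀ P : (((W.baseChange K).baseChange (v.adicCompletion K)).minimal
      (v.adicCompletionIntegers K)).toAffine.Point, p • P = 0 → P = 0 :=
    fun P hP ↦ eq_zero_of_hasAdditiveReduction_of_prime_nsmul_eq_zero
      (v.adicCompletionIntegers K) _ hp h5 hpk hP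
  obtain ⟨D, hD⟩ : ∃ D : VariableChange (v.adicCompletion K),
      ((W.baseChange K).baseChange (v.adicCompletion K)).minimal (v.adicCompletionIntegers K) =
        D • (W.baseChange K).baseChange (v.adicCompletion K) := ⟨_, rfl⟩
  rw [hD] at hX
  intro R hR
  have h := hX (VariableChange.pointEquiv ((W.baseChange K).baseChange (v.adicCompletion K)) D R)
    (by rw [← map_nsmul, hR, map_zero])
  exact (AddEquiv.map_eq_zero_iff _).mp h

/-- **`E(K_v)[p] = 0` above an ADDITIVE prime `ℓ` of `E/ℚ` unramified in `K`**: for any number field `K`,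
a finite place `v` of `K` above the rational prime `ℓ` with `ℓ ∤ d_K`, `E/ℚ` neither good nor
multiplicative at `ℓ`, and a prime `p ≥ 5`, `p ≠ ℓ`: no `K_v`-point of `E_K` of order `p`. The additive
type ascends along the unramified `ℚ_ℓ → K_v` (`e(v | ℓ) = 1` by Dedekind; tree theorem A233
`kodairaSymbolAt_baseChange_of_ramificationIdx_eq_one_holds`), then
`noPTorsion_adicCompletion_of_hasAdditiveReductionAt`. [cite: SilvermanAEC2009, Prop. VII.5.4 (a) with proof]
[cite: Mazur1977, Ch. III §5 Step 1 (p. 158)] -/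
theorem noPTorsion_adicCompletion_of_not_good_of_not_mult_of_not_dvd_discr (W : WeierstrassCurve ℚ)
    [W.IsElliptic] (ℓ : ℕ) [Fact ℓ.Prime] {p : ℕ} (hp : p.Prime) (h5 : 5 ≤ p) (hℓp : ℓ ≠ p)
    (hg : ¬ Good W ℓ) (hm : ¬ Mult W ℓ) {K : Type} [Field K] [NumberField K]
    (hℓd : ¬ (ℓ : ℤ) ∣ NumberField.discr K) (v : HeightOneSpectrum (𝓞 K))
    (hℓv : ((ℓ : ℕ) : 𝓞 K) ∈ v.asIdeal) :
    ∀ R : ((W.baseChange K).baseChange (v.adicCompletion K)).toAffine.Point, p • R = 0 → R = 0 := by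
  -- the place of `ℚ` under `v` is the one at `ℓ`
  set v₀ : HeightOneSpectrum (𝓞 ℚ) := v.under (𝓞 ℚ) with hv₀def
  haveI : v.asIdeal.LiesOver v₀.asIdeal := ⟨rfl⟩
  have hv₀ : v.under (𝓞 ℚ) = ratPlace ℓ := under_eq_ratPlace_of_mem hℓv
  have hℓeq : (Rat.HeightOneSpectrum.primesEquiv v₀ : ℕ) = ℓ := by
    rw [hv₀def, hv₀, primesEquiv_ratPlace]
  -- `p ∉ v` (as `ℓ ∈ v`, `ℓ ≠ p`, and `v ∩ ℤ` is the prime ideal `(ℓ)`)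
  have hpv : ((p : ℕ) : 𝓞 K) ∉ v.asIdeal := by
    intro hpv
    haveI : Fact p.Prime := ⟨hp⟩
    have h1 : v.under (𝓞 ℚ) = ratPlace p := under_eq_ratPlace_of_mem hpv
    have h2 : (Rat.HeightOneSpectrum.primesEquiv (v.under (𝓞 ℚ)) : ℕ) = p := by
      rw [h1, primesEquiv_ratPlace]
    rw [← hv₀def, hℓeq] at h2
    exact hℓp h2
  -- additive at `v₀`, then at `v` along the unramified `v | v₀`
  have hadd : W.HasAdditiveReductionAt v₀ :=
    hasAdditiveReductionAt_ratPlace_of_not_good_of_not_mult W ℓ hg hm v₀ hℓeq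
  have hℓd' : ¬ ((Rat.HeightOneSpectrum.primesEquiv v₀ : ℕ) : ℤ) ∣ NumberField.discr K := by
    rwa [hℓeq]
  have he : v.asIdeal.ramificationIdx (𝓞 ℚ) = 1 :=
    KolyvaginHloc.ramificationIdx_eq_one_of_not_dvd_discr v₀ v hℓd'
  haveI : PerfectField (IsLocalRing.ResidueField (v₀.adicCompletionIntegers ℚ)) := PerfectField.ofFinite
  haveI : Finite (IsLocalRing.ResidueField (v.adicCompletionIntegers K)) :=
    HeightOneSpectrum.finite_residueField_adicCompletionIntegers K v
  haveI : PerfectField (IsLocalRing.ResidueField (v.adicCompletionIntegers K)) := PerfectField.ofFinite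
  have hc : (algebraMap ℚ K).comp (algebraMap (𝓞 ℚ) ℚ) =
      (algebraMap (𝓞 K) K).comp (algebraMap (𝓞 ℚ) (𝓞 K)) := by
    rw [← IsScalarTower.algebraMap_eq, ← IsScalarTower.algebraMap_eq]
  have hwv : v.asIdeal.under (𝓞 ℚ) = v₀.asIdeal := rfl
  have haddK : (W.baseChange K).HasAdditiveReductionAt v :=
    hasAdditiveReductionAt_baseChange_of_ramificationIdx_eq_one
      (UnramifiedBaseChange.kodairaSymbolAt_baseChange_of_ramificationIdx_eq_one_holds K v₀ v W)
      hc hwv (KolyvaginHloc.not_map_le_sq_of_ramificationIdx_eq_one' hwv he) hadd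
  exact noPTorsion_adicCompletion_of_hasAdditiveReductionAt W hp h5 v hpv haddK

end Summit.BirchSwinnertonDyer.BirchSwinnertonDyer.Theorems.RamifiedSevenEllipticUnits

end
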